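import Mathlib
import Summits.ValiantsHypothesis.ValiantsHypothesis.Theorems.NewtonUnitEquationsDissociatedUniformTotalsLawGeneral
import Summits.ValiantsHypothesis.ValiantsHypothesis.Theorems.NewtonUnitEquationsDissociatedUniformTotalsLawConstant
import Summits.ValiantsHypothesis.ValiantsHypothesis.Theorems.NewtonUnitEquationsDissociatedUniformTotalsLawBinaryCount
import HarnessLib

/-!
# Crux `NewtonUnitEquations.DissociatedUniform` (stmt-ValiantsHypothesis-5905): the BINARY ROW of the general totals law — `T(n, ℤ/2) ≤ 4n`

Memo `Cruxes/DissociatedUniform/NOTES-d1g3.md` §3 / `NOTES-t1.md` §1, §5(iv) (crit-3 g2 read S2, the located `q = 2` row):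
the typed GENERAL totals law `TotalsLawN.TotalsLawGeneral C : ∀ n G c, T ≤ C·(n+1)·|G|²` (OPEN, never asserted; data
`T(n) ≈ (n-1)·q²`; at `q = 2` exact enumeration gives `max T(n, 2) = 4(n-1)`).  THIS FILE PROVES THE ROW `G = ℤ/2` WITH THE
CONSTANT OF RECORD `C = 1`, for every number `n` of coordinates and with no general-position hypothesis:

* `TotalsLawN.totalVert_zmod_two_le : 1 ≤ n → totalVert c ≤ 4 * n` for all `c : Fin n → ZMod 2 → ℝ²`;
* `TotalsLawN.totalsLawGeneral_one_zmod_two : totalVert c ≤ 1 * (n + 1) * Fintype.card (ZMod 2) ^ 2` — literally the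
  `G = ZMod 2` instance of the body of `TotalsLawGeneral 1`.

Proof (files `…TotalsLawBinaryRuns/Charts/Walk/Count`): a binary class is a translate of a PARITY CLASS of the subset sums
`P_K = ∑_{j ∈ K} (c_j 1 - c_j 0)` (`classPts_eq_vadd_cls`); hull vertices are chart tops along the two half-charts
`(±1, t)` (KPTT); along each half-chart both parity classes together have `≤ 2n` tops (`Binary.card_tops_add_card_tops_le`:
static top-two lemma + fine generic sample + runs theorem + flip budget).  Hence `T = V_0 + V_1 ≤ 2n + 2n`.
What this is NOT: nothing about `q → ∞` (the `n = 3` law `TotalsLaw.TotalsLawThree`, the general law for `|G| ≥ 3`, and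
`stub_smallShadow` stay OPEN); VP ≠ VNP is not touched.
[folklore: extreme points of the hull of a finite set lie in the set]
-/

set_option linter.dupNamespace false -- `ValiantsHypothesis.ValiantsHypothesis` (summit = problem) in every name

open scoped Classical BigOperators Pointwise
open Finset Matrix
open Literature.Computability.AlgebraicComplexity.KPTT.PlanarMinkowski (IsStrictTop mem_extremePoints_iff_charts)

namespace Summit.ValiantsHypothesis.ValiantsHypothesis.Theorems.NewtonUnitEquationsDissociatedUniform

namespace TotalsLawN

namespace Binary

variable {m : ℕ}

/-- Hull vertices of a parity class are chart tops along one of the two half-charts `(1, t)`, `(-1, t)`. [folklore] -/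
theorem ncard_extremePoints_cls_le (v : Fin (m + 1) → (Fin 2 → ℝ)) (e : ZMod 2) :
    ((convexHull ℝ (cls v e : Set (Fin 2 → ℝ))).extremePoints ℝ).ncard ≤ (tops v 1 e).card + (tops v (-1) e).card := by
  have hsub : (convexHull ℝ (cls v e : Set (Fin 2 → ℝ))).extremePoints ℝ ⊆ ↑(tops v 1 e ∪ tops v (-1) e) := by
    intro x hx
    have hxF : x ∈ cls v e := Finset.mem_coe.1 (extremePoints_convexHull_subset hx)
    rw [Finset.coe_union]
    rcases mem_extremePoints_iff_charts.1 hx with h | h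
    · exact Or.inl (Finset.mem_coe.2 (Finset.mem_filter.2 ⟨hxF, h⟩))
    · exact Or.inr (Finset.mem_coe.2 (Finset.mem_filter.2 ⟨hxF, h⟩))
  calc ((convexHull ℝ (cls v e : Set (Fin 2 → ℝ))).extremePoints ℝ).ncard
      ≤ (↑(tops v 1 e ∪ tops v (-1) e) : Set (Fin 2 → ℝ)).ncard := Set.ncard_le_ncard hsub (Finset.finite_toSet _)
    _ = (tops v 1 e ∪ tops v (-1) e).card := Set.ncard_coe_finset _
    _ ≤ (tops v 1 e).card + (tops v (-1) e).card := Finset.card_union_le _ _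

/-- The value of a binary curve as base point plus difference: `c_j x = c_j 0 + [x = 1]·(c_j 1 - c_j 0)`. [folklore] -/
theorem curve_apply_eq (c : Fin (m + 1) → ZMod 2 → (Fin 2 → ℝ)) (j : Fin (m + 1)) (x : ZMod 2) :
    c j x = c j 0 + (if x = 1 then c j 1 - c j 0 else 0) := by
  have hx : x = 0 ∨ x = 1 := by revert x; decide
  rcases hx with rfl | rfl
  · rw [if_neg (by decide), add_zero]
  · rw [if_pos rfl, add_sub_cancel]

/-- **Binary classes are translated parity classes.**  The (Q**) class `s` of the binary design `c` is the translate by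
`∑_j c_j 0` of the parity class `s` of the subset sums of the differences `c_j 1 - c_j 0`. [folklore] -/
theorem classPts_eq_vadd_cls (c : Fin (m + 1) → ZMod 2 → (Fin 2 → ℝ)) (s : ZMod 2) :
    TotalsLawN.classPts c s = (∑ j, c j 0) +ᵥ (cls (fun j => c j 1 - c j 0) s : Set (Fin 2 → ℝ)) := by
  ext p
  rw [Set.mem_vadd_set]
  simp only [TotalsLawN.classPts, Set.mem_range, Subtype.exists, Finset.mem_coe, mem_cls, vadd_eq_add]
  constructor
  · rintro ⟨x, hx, rfl⟩
    refine ⟨P (fun j => c j 1 - c j 0) (univ.filter fun j => x j = 1), ⟨univ.filter (fun j => x j = 1), ?_, rfl⟩, ?_⟩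
    · -- parity of the support
      rw [← hx]
      have : ∀ j, x j = if x j = 1 then (1 : ZMod 2) else 0 := fun j => by
        have hx : ∀ z : ZMod 2, z = if z = 1 then (1 : ZMod 2) else 0 := by decide
        exact hx (x j)
      rw [Finset.sum_congr rfl fun j _ => this j, Finset.sum_boole]
    · rw [P, Finset.sum_filter, ← Finset.sum_add_distrib]
      exact Finset.sum_congr rfl fun j _ => (curve_apply_eq c j (x j)).symm
  · rintro ⟨q, ⟨K, hK, rfl⟩, rfl⟩
    refine ⟨fun j => if j ∈ K then 1 else 0, ?_, ?_⟩
    · rw [Finset.sum_boole, Finset.filter_mem_eq_inter, Finset.univ_inter, hK]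
    · have hK' : ∑ j ∈ K, (c j 1 - c j 0) = ∑ j, if j ∈ K then (c j 1 - c j 0) else 0 := by
        rw [← Finset.sum_filter, Finset.filter_mem_eq_inter, Finset.univ_inter]
      rw [P, hK', ← Finset.sum_add_distrib]
      refine Finset.sum_congr rfl fun j _ => ?_
      beta_reduce
      by_cases h : j ∈ K
      · rw [if_pos h, if_pos h, add_sub_cancel]
      · rw [if_neg h, if_neg h, add_zero]

/-- `V_s` of a binary class is the hull-vertex count of the parity class. [folklore] -/
theorem classVert_eq_ncard_cls (c : Fin (m + 1) → ZMod 2 → (Fin 2 → ℝ)) (s : ZMod 2) :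
    TotalsLawN.classVert c s =
      ((convexHull ℝ (cls (fun j => c j 1 - c j 0) s : Set (Fin 2 → ℝ))).extremePoints ℝ).ncard := by
  unfold TotalsLawN.classVert
  rw [classPts_eq_vadd_cls, TotalsLaw.ncard_extremePoints_vadd]

/-- **`T(m + 1, ℤ/2) ≤ 4(m + 1)`.** [folklore] -/
theorem totalVert_le (c : Fin (m + 1) → ZMod 2 → (Fin 2 → ℝ)) : TotalsLawN.totalVert c ≤ 4 * (m + 1) := by
  unfold TotalsLawN.totalVert
  have h2 : ∑ s, TotalsLawN.classVert c s = TotalsLawN.classVert c 0 + TotalsLawN.classVert c 1 := Fin.sum_univ_two _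
  rw [h2, classVert_eq_ncard_cls, classVert_eq_ncard_cls]
  have h0 := ncard_extremePoints_cls_le (fun j => c j 1 - c j 0) 0
  have h1 := ncard_extremePoints_cls_le (fun j => c j 1 - c j 0) 1
  have hp := card_tops_add_card_tops_le (fun j => c j 1 - c j 0) 1
  have hn := card_tops_add_card_tops_le (fun j => c j 1 - c j 0) (-1)
  omega

end Binary

/-- **The binary row of the general totals law: `T(n, ℤ/2) ≤ 4n` (`n ≥ 1`).**  For the label group `ℤ/2`, every number `n ≥ 1`
of coordinates and all curves `c : Fin n → ZMod 2 → ℝ²`, the total class-hull vertex count of model (Q**) is at most `4n`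
(data: the maximum is `4(n - 1)`).  No general-position hypothesis. -/
theorem totalVert_zmod_two_le {n : ℕ} (hn : 1 ≤ n) (c : Fin n → ZMod 2 → (Fin 2 → ℝ)) : totalVert c ≤ 4 * n := by
  obtain ⟨m, rfl⟩ : ∃ m, n = m + 1 := ⟨n - 1, by omega⟩
  exact Binary.totalVert_le c

/-- **`TotalsLawGeneral 1` holds on the binary label group.**  For `G = ZMod 2` and every `n` and `c`:
`totalVert c ≤ 1 * (n + 1) * |ZMod 2|²` — literally the `G = ZMod 2` instance of the body of the typed conjecture
`TotalsLawN.TotalsLawGeneral 1` (which itself, for all finite abelian `G`, stays OPEN and is not asserted). -/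
theorem totalsLawGeneral_one_zmod_two (n : ℕ) (c : Fin n → ZMod 2 → (Fin 2 → ℝ)) :
    totalVert c ≤ 1 * (n + 1) * Fintype.card (ZMod 2) ^ 2 := by
  rw [ZMod.card]
  rcases Nat.eq_zero_or_pos n with rfl | hn
  · unfold totalVert
    calc ∑ s, classVert c s ≤ ∑ _s : ZMod 2, 1 :=
          Finset.sum_le_sum fun s _ => (classVert_le_card_pow c s).trans (by rw [pow_zero])
      _ ≤ 1 * (0 + 1) * 2 ^ 2 := by rw [Finset.sum_const, Finset.card_univ, ZMod.card]; norm_num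
  · exact (totalVert_zmod_two_le hn c).trans (by nlinarith)

end TotalsLawN

end Summit.ValiantsHypothesis.ValiantsHypothesis.Theorems.NewtonUnitEquationsDissociatedUniform
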